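import Summits.QuantumFields.YangMills.Theorems.BalabanUVNodesN27AtAllPinsOfRecord13CoPHVCutFSCFiniteVolume
import Summits.QuantumFields.YangMills.Theorems.BalabanUVNodesN18KernelStepRateKingMechanismZ4Lattices

/-!
# BalabanUVNodes ∕ N27 = binder B5 AT THE RECORD — storey APKZ: THE K3⁷ v5 ALL-PINS BILL (four reading pins + the spine pin, FSC key) WITH THE NODE-U3 INPUTS `hdec` ((D4)'s (5.10) class) AND
# `h18` (N18 at every run length) PRODUCED BY KING's THREE-FACTOR MECHANISM ON ℤ⁴ LATTICES for the record's LIMITING (1.21) kernels — dag-n18-w4's FILE 4 §10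
# (`…N18KernelStepRateKingMechanismZ4Lattices` p610557: `kernelStepRateOfRecord₁₃_of_threeFactorRates_zlattice` ∕ `kernelDecayOfRecord₁₃_of_threeFactorSizes_zlattice`, the mechanism's
# pseudo-distance and lattice-sum rows DISCHARGED by [B12]'s lattice constant `K₁(4, κ∕2)`) with FILE 2's `kernelStepRateOfRecord₁₃_mono` ∕ `kernelDecayOfRecord₁₃_anti` and dag-n18-w1's
# `n18At_u3OfRecord₁₃_objectsOfRecord₁₃_of_kernelStepRateOfRecord₁₃` — and the N22 input `h22` from dag-n18-w2's finite-volume door `n22At_u3OfRecord₁₃_objectsOfRecord₁₃_of_geometricIncrements_of_windowedNE9`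
# (p606911: `hr hinc h9`); companion of storey APK `…VCutFSCKingMechanism` (the WINDOWED-kernel edition on generic lattices)
# (cell `pub-ymgap`, HUMAN RULING D-0062 Track A, R134 seat `pub-ymgap-dag-n27-c` (N27 B5 composite, s2) gen 14, HOME trigger (t2⁗) «new producer currency at the pinned reading» — dag-n18-w4
# OFFER (A) ∕ FILE 4; K3⁷ `SpineGivenEndpointR13SepCoPH` = stmt-QuantumFields-20544, `--kind proof --supports 20544 --as helper`; COUNT-NEUTRAL; THEOREMS ONLY, 0 `def`, 0 `sorry`; `N`-generic,
# `K₀`-generic, regime-generic, NO Theses import, does NOT import the skeleton — item faces in leaf `…N27SpineGivenEndpointR13SepCoPHAllPinsOfRecordVKingMechanismZ4`; AP p605269 §1 is the parent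
# storey theorem, applied BY NAME)

WHAT IS KERNEL-CHECKED ([bookkeeping]; per guarded tuple ONE application of dag-n18-w4's two §10 producers, FILE 2's monotonicity faces and dag-n18-w1's letter face; then AP §1 verbatim with
its `hrows` discharged behind the four pins exactly as in APF §1).
* §0 ★★ `kernelRowsOfRecord₁₃_guarded_of_kingMechanismZ4` — per regime `Rg`, from KING's MECHANISM ROWS ON ℤ⁴ LATTICES keyed `∀ F θ, Provisos₁₃CoPH → Rg → Admissible → …` on `(F, θ)`-DEPENDENT
  data: a level-indexed summation lattice `βK F θ k` read INJECTIVELY into ℤ⁴ by `q` (`hq`), end positions `p₁ ∕ p₂` at separation `≥ |z|₁` (`hd`), a run-A three-factor datum `(uA, CA, vA)`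
  indexed by the window history `g` factorising the record's limiting kernel functional `(objectsOfRecord₁₃ F N θ' ℓ).EA k g () (pt k μ ν z)` (`hEA`) and a run-B datum `(uB, CB, vB)` indexed by
  the unpaired first coupling `b ∈ ]0, γ]` and `g` factorising `.EB k b g (bg k μ ν z) (pt k μ ν z)` (`hEB`); k-UNIFORM sizes `hu hCA hvA hCB hvB`; ONE-LINE RATES `hdu hdC hdv ≤ c·θK^{k+1}`; signs
  `hks` (`κK > 0`); ONE domination row `hdom : (ℓ F θ).κ ≤ κK∕2 ∧ θK ≤ (ℓ F θ).θ₅ ∧ (cA·sC·sB + sA·cC·sB + sA·sC·cB)·K₁(4, κK∕2)² ≤ (ℓ F θ).C₅` ⟹ AP §1's two u3 rows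
  `hdec : KernelDecayOfRecord₁₃ F N θ' 0 1 (ℓ F θ).κ` and `h18 : ∀ k, N18At (u3OfRecord₁₃ θ' (objectsOfRecord₁₃ F N θ' (ℓ F θ)) k)` (`θ' := θ.toStage13Params`).  NO pseudo-distance ∕ lattice-sum rows.
* §1 ★★★ `spine_rec13CCoPHOn_of_v5pins_fsc_at_crOfRecord₁₃VAt_cut_of_kingMechanismZ4` — AP §1 `…_of_kernels_pin_fsc_at_crOfRecord₁₃VAt_cut` with `hrows` discharged behind the four pins (as APF §1),
  `hdec h18 ⟸ §0`, `h22 ⟸` dag-n18-w2's door from `hs hr hinc h9`: any regime `Rg`.  Displayed: the four pins · `h16` · `hs hκ hcr hρ` · `hr hinc h9` · the FOURTEEN ℤ⁴ King rows · `hsel hζm` · keyed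
  `h20 h21` · FSC `h19` at the spelled `PHolderD4 β`.
* §2 ★★★ `spine_rec13CCoPHOn_live_of_v5pins_fsc_at_crOfRecord₁₃VAt_cut_of_kingMechanismZ4` — §1 ON THE LIVE LINE of a regime `G` (`Rg := G ∧ LiveSel` spelled `N`-generically; `hsel := hRg.2`).
Consumed BY NAME: AP §1 (gen 13; through it UC4, UC §0, dag-n20-d transfers, dag-n19-w3's FSC composer, (Kꜰ) §1); dag-n18-w4 FILE 4 §10 (p610557; through it FILE 1∕2 p606901∕p607866, [B12]'s
`K₁` ∕ `sum_exp_neg_l1_sub_le`); dag-n18-w1 p597580; dag-n18-w2 p606911; pins and faces of dag-n14-w1 ∕ dag-n15-a ∕ dag-n16-e as in APF.  Nothing landed is edited or re-declared.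

HONEST FRAMING.  COMPOSITE-node bookkeeping BY NAME; a REDUCTION, not a discharge.  KING's ROWS ARE HYPOTHESES: the three-factor structure `u ⬝ (E v)` of Bałaban's limiting (1.21)
kernel functionals over ℤ⁴-read summation lattices, the k-UNIFORM sizes and the one-line rates `c·θK^{k+1}` ARE the N18 ∕ (D4) estimate — C. King's printed MODEL of the mechanism
([King1986] Prop. 3.9 (3.73) p. 665, (4.42)–(4.43) p. 675) typed by dag-n18-w4 for Bałaban's vacuum-polarisation kernels; for d = 4 Yang–Mills NOT PRINTED ([Balaban1987RG1] Thm 1 p. 259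
prints uniformity in the spacing only) and proved nowhere in the tree; only the GEOMETRY (pseudo-distance, lattice sums) is discharged, by [B12]'s `K₁`.  Every other displayed antecedent is a
HYPOTHESIS inhabited for no family today (K0⁷ `Record13SepCoPHInhabited` OPEN) or a decided MODEL behind a pin; pins are hypotheses on a FREE reading `𝔯` (no reading minted); `jc sh ℓ s r ℓ₃ B 𝔯
β` and ALL King data ∕ letters are FREE PARAMETERS; nothing of Bałaban's or King's asserted or instantiated; NOT `stub_rates13H` ∕ `stub_expansion13H`; N14–N22 ∕ N27 NOT discharged (the chair
books, R417); K3⁷ OPEN, NOT claimed; skeleton v5 untouched; counts UNMOVED (typed 28∕28 · discharged 5∕27, A 5∕28); one finite four-torus programme at fixed `ε` — NOT ℝ⁴, NOT infinite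
volume, NOT OS, NOT a mass gap, NOT Clay.  No decl below carries a cite tag.
-/

set_option autoImplicit false

namespace Summit.QuantumFields.YangMills.Theorems.BalabanUVNodesN27SpineRecord

open scoped BigOperators Matrix.Norms.L2Operator
open Literature.MathematicalPhysics.QuantumFieldTheory.Balaban1983to89
open Literature.MathematicalPhysics.QuantumFieldTheory.Balaban1983to89.T4Continuum
open Literature.MathematicalPhysics.QuantumFieldTheory.Balaban1983to89.Node00
open Literature.MathematicalPhysics.QuantumFieldTheory.Balaban1983to89.B12Sec2to5 (betaPrime510 l1)
open Literature.MathematicalPhysics.QuantumFieldTheory.Balaban1983to89.B12Decay510Window (K₁)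
open Literature.MathematicalPhysics.QuantumFieldTheory.Balaban1983to89.T4OutputRate (Window)
open Literature.MathematicalPhysics.QuantumFieldTheory.Balaban1983to89.Node00.U3OfKernels (objectsOfRecord₁₃ KernelDecayOfRecord₁₃ pt bg)
open Literature.MathematicalPhysics.QuantumFieldTheory.Balaban1983to89.Node00.U3KernelLetters (GeometricIncrementsOfRecord₁₃ WindowedNE9OfRecord₁₃ WindowedDecayOfRecord₁₃
  WindowedStepRateOfRecord₁₃)
open T4WeightBudget (RelWeightBound)
open T4IndicatorShell (ShellWeightBound)
open T4ContinuumYM4Torus (ForSmallCouplings)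
open Summit.QuantumFields.BalabanUV.T4Continuum.Spine
open YMDAG.UVSplit
open Summit.QuantumFields.BalabanUV.T4Continuum.MinimalActionRate (sfClass)
open Summit.QuantumFields.YangMills.BalabanUVNodes.N19TargetClassWeightsE1Keyed
open Summit.QuantumFields.YangMills.BalabanUVNodes.N16HolderDefs (N16HolderAt)
open Summit.QuantumFields.YangMills.BalabanUVNodes.SpineRatesHolder (RatesHolderAt)
open YMDAG.N14.TopBorn (Ne1PinnedOfRecord n14At_rateCarriersOfRecord₁₃CoPH_of_pinned)
open Summit.QuantumFields.YangMills.BalabanUVNodes.N15.GenuineRecord (fullGSizedObjects n15At_fullGSizedObjects_family)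
open Summit.QuantumFields.YangMills.BalabanUVNodes.N15.AtKeyedHome (neZero_blockFactor)
open Summit.QuantumFields.YangMills.BalabanUVNodes.N16PinnedLayer13CoPH (N16PinnedLoose rateCarriers_ne3_of_pinnedLoose)
open YMDAG.N18.PolLimitRate (n22At_u3OfRecord₁₃_objectsOfRecord₁₃_of_geometricIncrements_of_windowedNE9)
open YMDAG.N18.KernelStepRateKingMechanism (kernelStepRateOfRecord₁₃_of_threeFactorRates_zlattice kernelStepRateOfRecord₁₃_mono kernelDecayOfRecord₁₃_of_threeFactorSizes_zlattice
  kernelDecayOfRecord₁₃_anti)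
open YMDAG.N18.AtRecordOfKernelLetters (n18At_u3OfRecord₁₃_objectsOfRecord₁₃_of_kernelStepRateOfRecord₁₃)
open Matrix

variable {N : ℕ} [NeZero N] (K₀ : ℕ)
  (jc : (F : T4Family) → (θ : Stage13HParams F N) → θ.Provisos₁₃CoPH F N → (ℕ → ℝ) → List (ULoop F) → ℕ → ℕ)
  (sh : ShellSplit₁₃CoPH N K₀) (β : ℝ) (𝔯 : RateReading₁₃CoPH N)
  (ksel : (F : T4Family) → (θ : Stage13HParams F N) → θ.Provisos₁₃CoPH F N → (ℕ → ℝ) → List (ULoop F) → ℕ)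
  (ℓ : (F : T4Family) → Stage13HParams F N → U3Letters₁₁) (s : (F : T4Family) → Stage13HParams F N → ℕ) (r : (F : T4Family) → Stage13HParams F N → ℝ)
  (ℓ₃ : T4Family → NE3Letters₁₁) (B : T4Family → ℝ)

-- KING's three-factor data for the record's LIMITING kernels on ℤ⁴ lattices (dag-n18-w4 FILE 4 §10), `(F, θ)`-dependent; `k` = level, `g` = window history, `b` = run B's first coupling
variable {βK : (F : T4Family) → Stage13HParams F N → ℕ → Type*} [∀ F θ k, Fintype (βK F θ k)]
  (q : (F : T4Family) → (θ : Stage13HParams F N) → (k : ℕ) → βK F θ k → (Fin 4 → ℤ))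
  (p₁ p₂ : (F : T4Family) → (θ : Stage13HParams F N) → (k : ℕ) → Fin 4 → Fin 4 → (Fin 4 → ℤ) → (Fin 4 → ℤ))
  (uA vA : (F : T4Family) → (θ : Stage13HParams F N) → (ℕ → ℝ) → (k : ℕ) → Fin 4 → Fin 4 → (Fin 4 → ℤ) → βK F θ k → ℝ)
  (CA : (F : T4Family) → (θ : Stage13HParams F N) → (ℕ → ℝ) → (k : ℕ) → Fin 4 → Fin 4 → (Fin 4 → ℤ) → Matrix (βK F θ k) (βK F θ k) ℝ)
  (uB vB : (F : T4Family) → (θ : Stage13HParams F N) → ℝ → (ℕ → ℝ) → (k : ℕ) → Fin 4 → Fin 4 → (Fin 4 → ℤ) → βK F θ k → ℝ)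
  (CB : (F : T4Family) → (θ : Stage13HParams F N) → ℝ → (ℕ → ℝ) → (k : ℕ) → Fin 4 → Fin 4 → (Fin 4 → ℤ) → Matrix (βK F θ k) (βK F θ k) ℝ)
  (κK θK sA sC sB cA cC cB : (F : T4Family) → Stage13HParams F N → ℝ)

/-! ## §0 KING's MECHANISM ROWS ON ℤ⁴ LATTICES ⟹ AP §1's u3 inputs `hdec` ((D4)) and `h18` (N18), per regime (dag-n18-w4 FILE 4 §10 + FILE 2's monotonicity faces + dag-n18-w1's letter face, BY NAME) -/

/-- ★★ **THE (D4) INPUT `hdec` AND THE N18 INPUT `h18` OF AP §1 FROM KING's THREE-FACTOR MECHANISM ON ℤ⁴ LATTICES FOR THE RECORD's LIMITING KERNELS, PER REGIME** (dag-n18-w4 FILE 4 §10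
BY NAME: `kernelStepRateOfRecord₁₃_of_threeFactorRates_zlattice` then FILE 2's `kernelStepRateOfRecord₁₃_mono` at the domination row (`0 ≤ (ℓ F θ).C₅` by `Signs`) then dag-n18-w1's
`n18At_u3OfRecord₁₃_objectsOfRecord₁₃_of_kernelStepRateOfRecord₁₃`; `kernelDecayOfRecord₁₃_of_threeFactorSizes_zlattice … 0 1` then `kernelDecayOfRecord₁₃_anti`).  Every King row is a
HYPOTHESIS — the three-factor structure ∕ k-uniform sizes ∕ one-line rates of Bałaban's limiting (1.21) kernel functionals ARE the estimate ([King1986] p. 665, (4.42)–(4.43) p. 675 typed; NOT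
PRINTED for d = 4; proved nowhere); only the geometry is discharged ([B12]'s `K₁`); N18 ∕ (D4) NOT discharged. [bookkeeping] -/
theorem kernelRowsOfRecord₁₃_guarded_of_kingMechanismZ4 (Rg : (F : T4Family) → Stage13HParams F N → Prop)
    (hs : ∀ (F : T4Family) (θ : Stage13HParams F N), θ.Provisos₁₃CoPH F N → Rg F θ → θ.Admissible F N → (ℓ F θ).Signs)
    (hks : ∀ (F : T4Family) (θ : Stage13HParams F N), θ.Provisos₁₃CoPH F N → Rg F θ → θ.Admissible F N →
      0 < κK F θ ∧ 0 ≤ θK F θ ∧ 0 ≤ sA F θ ∧ 0 ≤ sC F θ ∧ 0 ≤ sB F θ ∧ 0 ≤ cA F θ ∧ 0 ≤ cC F θ ∧ 0 ≤ cB F θ)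
    (hq : ∀ (F : T4Family) (θ : Stage13HParams F N) (k : ℕ), Function.Injective (q F θ k))
    (hd : ∀ (F : T4Family) (θ : Stage13HParams F N) (k : ℕ) (μ ν : Fin 4) (z : Fin 4 → ℤ), l1 z ≤ l1 (p₁ F θ k μ ν z - p₂ F θ k μ ν z))
    (hEA : ∀ (F : T4Family) (θ : Stage13HParams F N), θ.Provisos₁₃CoPH F N → Rg F θ → θ.Admissible F N →
      ∀ g ∈ Window θ.γ, ∀ (k : ℕ) (μ ν : Fin 4) (z : Fin 4 → ℤ),
        (objectsOfRecord₁₃ F N θ.toStage13Params (ℓ F θ)).EA k g PUnit.unit (pt k μ ν z) = uA F θ g k μ ν z ⬝ᵥ (CA F θ g k μ ν z *ᵥ vA F θ g k μ ν z))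
    (hEB : ∀ (F : T4Family) (θ : Stage13HParams F N), θ.Provisos₁₃CoPH F N → Rg F θ → θ.Admissible F N →
      ∀ b : ℝ, 0 < b → b ≤ θ.γ → ∀ g ∈ Window θ.γ, ∀ (k : ℕ) (μ ν : Fin 4) (z : Fin 4 → ℤ),
        (objectsOfRecord₁₃ F N θ.toStage13Params (ℓ F θ)).EB k b g (bg k μ ν z) (pt k μ ν z) = uB F θ b g k μ ν z ⬝ᵥ (CB F θ b g k μ ν z *ᵥ vB F θ b g k μ ν z))
    (hu : ∀ (F : T4Family) (θ : Stage13HParams F N), θ.Provisos₁₃CoPH F N → Rg F θ → θ.Admissible F N →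
      ∀ g ∈ Window θ.γ, ∀ (k : ℕ) (μ ν : Fin 4) (z : Fin 4 → ℤ) (i : βK F θ k),
        |uA F θ g k μ ν z i| ≤ sA F θ * Real.exp (-(κK F θ * l1 (p₁ F θ k μ ν z - q F θ k i))))
    (hCA : ∀ (F : T4Family) (θ : Stage13HParams F N), θ.Provisos₁₃CoPH F N → Rg F θ → θ.Admissible F N →
      ∀ g ∈ Window θ.γ, ∀ (k : ℕ) (μ ν : Fin 4) (z : Fin 4 → ℤ) (i i' : βK F θ k),
        |CA F θ g k μ ν z i i'| ≤ sC F θ * Real.exp (-(κK F θ * l1 (q F θ k i - q F θ k i'))))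
    (hvA : ∀ (F : T4Family) (θ : Stage13HParams F N), θ.Provisos₁₃CoPH F N → Rg F θ → θ.Admissible F N →
      ∀ g ∈ Window θ.γ, ∀ (k : ℕ) (μ ν : Fin 4) (z : Fin 4 → ℤ) (i' : βK F θ k),
        |vA F θ g k μ ν z i'| ≤ sB F θ * Real.exp (-(κK F θ * l1 (q F θ k i' - p₂ F θ k μ ν z))))
    (hCB : ∀ (F : T4Family) (θ : Stage13HParams F N), θ.Provisos₁₃CoPH F N → Rg F θ → θ.Admissible F N →
      ∀ b : ℝ, 0 < b → b ≤ θ.γ → ∀ g ∈ Window θ.γ, ∀ (k : ℕ) (μ ν : Fin 4) (z : Fin 4 → ℤ) (i i' : βK F θ k),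
        |CB F θ b g k μ ν z i i'| ≤ sC F θ * Real.exp (-(κK F θ * l1 (q F θ k i - q F θ k i'))))
    (hvB : ∀ (F : T4Family) (θ : Stage13HParams F N), θ.Provisos₁₃CoPH F N → Rg F θ → θ.Admissible F N →
      ∀ b : ℝ, 0 < b → b ≤ θ.γ → ∀ g ∈ Window θ.γ, ∀ (k : ℕ) (μ ν : Fin 4) (z : Fin 4 → ℤ) (i' : βK F θ k),
        |vB F θ b g k μ ν z i'| ≤ sB F θ * Real.exp (-(κK F θ * l1 (q F θ k i' - p₂ F θ k μ ν z))))
    (hdu : ∀ (F : T4Family) (θ : Stage13HParams F N), θ.Provisos₁₃CoPH F N → Rg F θ → θ.Admissible F N →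
      ∀ b : ℝ, 0 < b → b ≤ θ.γ → ∀ g ∈ Window θ.γ, ∀ (k : ℕ) (μ ν : Fin 4) (z : Fin 4 → ℤ) (i : βK F θ k),
        |uB F θ b g k μ ν z i - uA F θ g k μ ν z i| ≤ cA F θ * θK F θ ^ (k + 1) * Real.exp (-(κK F θ * l1 (p₁ F θ k μ ν z - q F θ k i))))
    (hdC : ∀ (F : T4Family) (θ : Stage13HParams F N), θ.Provisos₁₃CoPH F N → Rg F θ → θ.Admissible F N →
      ∀ b : ℝ, 0 < b → b ≤ θ.γ → ∀ g ∈ Window θ.γ, ∀ (k : ℕ) (μ ν : Fin 4) (z : Fin 4 → ℤ) (i i' : βK F θ k),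
        |CB F θ b g k μ ν z i i' - CA F θ g k μ ν z i i'| ≤ cC F θ * θK F θ ^ (k + 1) * Real.exp (-(κK F θ * l1 (q F θ k i - q F θ k i'))))
    (hdv : ∀ (F : T4Family) (θ : Stage13HParams F N), θ.Provisos₁₃CoPH F N → Rg F θ → θ.Admissible F N →
      ∀ b : ℝ, 0 < b → b ≤ θ.γ → ∀ g ∈ Window θ.γ, ∀ (k : ℕ) (μ ν : Fin 4) (z : Fin 4 → ℤ) (i' : βK F θ k),
        |vB F θ b g k μ ν z i' - vA F θ g k μ ν z i'| ≤ cB F θ * θK F θ ^ (k + 1) * Real.exp (-(κK F θ * l1 (q F θ k i' - p₂ F θ k μ ν z))))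
    (hdom : ∀ (F : T4Family) (θ : Stage13HParams F N), θ.Provisos₁₃CoPH F N → Rg F θ → θ.Admissible F N →
      (ℓ F θ).κ ≤ κK F θ / 2 ∧ θK F θ ≤ (ℓ F θ).θ₅ ∧
        (cA F θ * sC F θ * sB F θ + sA F θ * cC F θ * sB F θ + sA F θ * sC F θ * cB F θ) * K₁ 4 (κK F θ / 2) ^ 2 ≤ (ℓ F θ).C₅) :
    (∀ (F : T4Family) (θ : Stage13HParams F N), θ.Provisos₁₃CoPH F N → Rg F θ → θ.Admissible F N →
      KernelDecayOfRecord₁₃ F N θ.toStage13Params 0 1 (ℓ F θ).κ) ∧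
    (∀ (F : T4Family) (θ : Stage13HParams F N), θ.Provisos₁₃CoPH F N → Rg F θ → θ.Admissible F N →
      ∀ k : ℕ, N18At (u3OfRecord₁₃ θ.toStage13Params (objectsOfRecord₁₃ F N θ.toStage13Params (ℓ F θ)) k)) := by
  refine ⟨fun F θ hP hRg hθ => ?_, fun F θ hP hRg hθ k => ?_⟩
  · obtain ⟨hκ0, -, hsA0, hsC0, hsB0, -⟩ := hks F θ hP hRg hθ
    exact kernelDecayOfRecord₁₃_anti F N θ.toStage13Params
      (kernelDecayOfRecord₁₃_of_threeFactorSizes_zlattice F N θ.toStage13Params (ℓ F θ) (q F θ) (hq F θ) (p₁ F θ) (p₂ F θ) (uA F θ) (vA F θ) (CA F θ)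
        hκ0 hsA0 hsC0 hsB0 (hEA F θ hP hRg hθ) (hu F θ hP hRg hθ) (hCA F θ hP hRg hθ) (hvA F θ hP hRg hθ) (hd F θ) 0 1)
      (hdom F θ hP hRg hθ).1
  · obtain ⟨hκ0, hθ0, hsA0, hsC0, hsB0, hcA0, hcC0, hcB0⟩ := hks F θ hP hRg hθ
    obtain ⟨hkκ, hkθ, hkC⟩ := hdom F θ hP hRg hθ
    exact n18At_u3OfRecord₁₃_objectsOfRecord₁₃_of_kernelStepRateOfRecord₁₃ F N θ.toStage13Params (ℓ F θ) k
      (kernelStepRateOfRecord₁₃_mono F N θ.toStage13Params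
        (kernelStepRateOfRecord₁₃_of_threeFactorRates_zlattice F N θ.toStage13Params (ℓ F θ) (q F θ) (hq F θ) (p₁ F θ) (p₂ F θ) (uA F θ) (vA F θ) (CA F θ)
          (uB F θ) (vB F θ) (CB F θ) hκ0 hθ0 hsA0 hsC0 hsB0 hcA0 hcC0 hcB0 (hEA F θ hP hRg hθ) (hEB F θ hP hRg hθ) (hu F θ hP hRg hθ) (hCA F θ hP hRg hθ)
          (hCB F θ hP hRg hθ) (hvB F θ hP hRg hθ) (hdu F θ hP hRg hθ) (hdC F θ hP hRg hθ) (hdv F θ hP hRg hθ) (hd F θ))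
        hkκ hθ0 hkθ hkC (hs F θ hP hRg hθ).C₅_nonneg)

/-! ## §1 All four v5 reading pins + the spine pin, any regime; u3 block = `hr hinc h9` (N22 via dag-n18-w2) + KING's ℤ⁴ MECHANISM ROWS for `hdec`∕`h18` -/

/-- ★★★ **N27 = B5 AT THE REGIME RECORD CLASS FROM A READING CARRYING ALL FOUR v5 PINS, K5 AT THE PER-TUPLE-CUT SPINE READING OF RECORD — KING-MECHANISM-ON-ℤ⁴ EDITION**
(AP §1 `spine_rec13CCoPHOn_of_kernels_pin_fsc_at_crOfRecord₁₃VAt_cut` with its `hrows` DISCHARGED behind the four pins exactly as in APF §1, its (D4) ∕ N18 inputs `hdec h18` SUPPLIED by §0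
from King's three-factor mechanism rows on ℤ⁴ lattices for the record's limiting kernels — dag-n18-w4 FILE 4 §10 BY NAME — and its N22 input `h22` by dag-n18-w2's
`n22At_u3OfRecord₁₃_objectsOfRecord₁₃_of_geometricIncrements_of_windowedNE9` from `hs hr hinc h9`).  Displayed: the four pins · `h16` · `hs hκ hcr hρ` · `hr hinc h9` · the fourteen ℤ⁴ King rows
`hks hq hd hEA hEB hu hCA hvA hCB hvB hdu hdC hdv hdom` · `hsel hζm` · keyed `h20 h21` · FSC `h19` at the spelled `PHolderD4 β`.  Every row a HYPOTHESIS or a decided MODEL (0∕1 today); King's rows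
ARE the N18 ∕ (D4) estimate, NOT PRINTED for d = 4; nothing proved of Bałaban's or King's; NOT `stub_rates13H` ∕ `stub_expansion13H`; no node discharged. [bookkeeping] -/
theorem spine_rec13CCoPHOn_of_v5pins_fsc_at_crOfRecord₁₃VAt_cut_of_kingMechanismZ4 (Rg : (F : T4Family) → Stage13HParams F N → Prop)
    (hpin1 : Ne1PinnedOfRecord 𝔯)
    (hpin2 : ∃ (b aS : ℝ) (ν μ α β' : Fin 4) (c35 p : ℝ), 0 < b ∧ 0 < aS ∧
      ∀ (F : T4Family) (θ : Stage13HParams F N) (hP : θ.Provisos₁₃CoPH F N) (g₀ : ℕ → ℝ) (os : List (ULoop F)) (k : ℕ),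
        (𝔯.lit F θ hP g₀ os).ne2 k = haveI := neZero_blockFactor F; fullGSizedObjects 3 F.hL b aS ν μ α β' c35 p)
    (hpinL : N16PinnedLoose 𝔯 ℓ₃ B)
    (hpin : ∀ (F : T4Family) (θ : Stage13HParams F N) (hP : θ.Provisos₁₃CoPH F N) (g₀ : ℕ → ℝ) (os : List (ULoop F)),
      (𝔯.lit F θ hP g₀ os).u3 = objectsOfRecord₁₃ F N θ.toStage13Params (ℓ F θ))
    (h16 : ∀ (F : T4Family), (∃ θ : Stage13HParams F N, θ.Provisos₁₃CoPH F N ∧ Rg F θ ∧ θ.Admissible F N) →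
      N16HolderAt (ne3OfRecord₁₁ F { ne3ConstLayerOfRecord₁₁ F N (ℓ₃ F) with
        dom := {V | V ∈ ne3DomOfRecord₁₁ F N 0 0 ∧ V ∈ sfClass 4 F.L (ne3NperOfRecord₁₁ F 0 0) ((ℓ₃ F).ε / B F) 0} }) β)
    (hs : ∀ (F : T4Family) (θ : Stage13HParams F N), θ.Provisos₁₃CoPH F N → Rg F θ → θ.Admissible F N → (ℓ F θ).Signs)
    (hκ : ∀ (F : T4Family) (θ : Stage13HParams F N), θ.Provisos₁₃CoPH F N → Rg F θ → θ.Admissible F N → 0 < (ℓ F θ).κ)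
    (hcr : ∀ (F : T4Family) (θ : Stage13HParams F N), θ.Provisos₁₃CoPH F N → Rg F θ → θ.Admissible F N →
      betaPrime510 4 1 (ℓ F θ).κ ≤ (ℓ F θ).cr)
    (hρ : ∀ (F : T4Family) (θ : Stage13HParams F N), θ.Provisos₁₃CoPH F N → Rg F θ → θ.Admissible F N →
      0 ≤ (ℓ F θ).ρ ∧ (ℓ F θ).ρ < 1)
    (hr : ∀ (F : T4Family) (θ : Stage13HParams F N), θ.Provisos₁₃CoPH F N → Rg F θ → θ.Admissible F N → r F θ < 1)
    (hinc : ∀ (F : T4Family) (θ : Stage13HParams F N), θ.Provisos₁₃CoPH F N → Rg F θ → θ.Admissible F N →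
      GeometricIncrementsOfRecord₁₃ F N θ.toStage13Params (r F θ))
    (h9 : ∀ (F : T4Family) (θ : Stage13HParams F N), θ.Provisos₁₃CoPH F N → Rg F θ → θ.Admissible F N →
      WindowedNE9OfRecord₁₃ F N θ.toStage13Params (ℓ F θ).κ (ℓ F θ).moduli)
    (hks : ∀ (F : T4Family) (θ : Stage13HParams F N), θ.Provisos₁₃CoPH F N → Rg F θ → θ.Admissible F N →
      0 < κK F θ ∧ 0 ≤ θK F θ ∧ 0 ≤ sA F θ ∧ 0 ≤ sC F θ ∧ 0 ≤ sB F θ ∧ 0 ≤ cA F θ ∧ 0 ≤ cC F θ ∧ 0 ≤ cB F θ)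
    (hq : ∀ (F : T4Family) (θ : Stage13HParams F N) (k : ℕ), Function.Injective (q F θ k))
    (hd : ∀ (F : T4Family) (θ : Stage13HParams F N) (k : ℕ) (μ ν : Fin 4) (z : Fin 4 → ℤ), l1 z ≤ l1 (p₁ F θ k μ ν z - p₂ F θ k μ ν z))
    (hEA : ∀ (F : T4Family) (θ : Stage13HParams F N), θ.Provisos₁₃CoPH F N → Rg F θ → θ.Admissible F N →
      ∀ g ∈ Window θ.γ, ∀ (k : ℕ) (μ ν : Fin 4) (z : Fin 4 → ℤ),
        (objectsOfRecord₁₃ F N θ.toStage13Params (ℓ F θ)).EA k g PUnit.unit (pt k μ ν z) = uA F θ g k μ ν z ⬝ᵥ (CA F θ g k μ ν z *ᵥ vA F θ g k μ ν z))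
    (hEB : ∀ (F : T4Family) (θ : Stage13HParams F N), θ.Provisos₁₃CoPH F N → Rg F θ → θ.Admissible F N →
      ∀ b : ℝ, 0 < b → b ≤ θ.γ → ∀ g ∈ Window θ.γ, ∀ (k : ℕ) (μ ν : Fin 4) (z : Fin 4 → ℤ),
        (objectsOfRecord₁₃ F N θ.toStage13Params (ℓ F θ)).EB k b g (bg k μ ν z) (pt k μ ν z) = uB F θ b g k μ ν z ⬝ᵥ (CB F θ b g k μ ν z *ᵥ vB F θ b g k μ ν z))
    (hu : ∀ (F : T4Family) (θ : Stage13HParams F N), θ.Provisos₁₃CoPH F N → Rg F θ → θ.Admissible F N →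
      ∀ g ∈ Window θ.γ, ∀ (k : ℕ) (μ ν : Fin 4) (z : Fin 4 → ℤ) (i : βK F θ k),
        |uA F θ g k μ ν z i| ≤ sA F θ * Real.exp (-(κK F θ * l1 (p₁ F θ k μ ν z - q F θ k i))))
    (hCA : ∀ (F : T4Family) (θ : Stage13HParams F N), θ.Provisos₁₃CoPH F N → Rg F θ → θ.Admissible F N →
      ∀ g ∈ Window θ.γ, ∀ (k : ℕ) (μ ν : Fin 4) (z : Fin 4 → ℤ) (i i' : βK F θ k),
        |CA F θ g k μ ν z i i'| ≤ sC F θ * Real.exp (-(κK F θ * l1 (q F θ k i - q F θ k i'))))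
    (hvA : ∀ (F : T4Family) (θ : Stage13HParams F N), θ.Provisos₁₃CoPH F N → Rg F θ → θ.Admissible F N →
      ∀ g ∈ Window θ.γ, ∀ (k : ℕ) (μ ν : Fin 4) (z : Fin 4 → ℤ) (i' : βK F θ k),
        |vA F θ g k μ ν z i'| ≤ sB F θ * Real.exp (-(κK F θ * l1 (q F θ k i' - p₂ F θ k μ ν z))))
    (hCB : ∀ (F : T4Family) (θ : Stage13HParams F N), θ.Provisos₁₃CoPH F N → Rg F θ → θ.Admissible F N →
      ∀ b : ℝ, 0 < b → b ≤ θ.γ → ∀ g ∈ Window θ.γ, ∀ (k : ℕ) (μ ν : Fin 4) (z : Fin 4 → ℤ) (i i' : βK F θ k),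
        |CB F θ b g k μ ν z i i'| ≤ sC F θ * Real.exp (-(κK F θ * l1 (q F θ k i - q F θ k i'))))
    (hvB : ∀ (F : T4Family) (θ : Stage13HParams F N), θ.Provisos₁₃CoPH F N → Rg F θ → θ.Admissible F N →
      ∀ b : ℝ, 0 < b → b ≤ θ.γ → ∀ g ∈ Window θ.γ, ∀ (k : ℕ) (μ ν : Fin 4) (z : Fin 4 → ℤ) (i' : βK F θ k),
        |vB F θ b g k μ ν z i'| ≤ sB F θ * Real.exp (-(κK F θ * l1 (q F θ k i' - p₂ F θ k μ ν z))))
    (hdu : ∀ (F : T4Family) (θ : Stage13HParams F N), θ.Provisos₁₃CoPH F N → Rg F θ → θ.Admissible F N →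
      ∀ b : ℝ, 0 < b → b ≤ θ.γ → ∀ g ∈ Window θ.γ, ∀ (k : ℕ) (μ ν : Fin 4) (z : Fin 4 → ℤ) (i : βK F θ k),
        |uB F θ b g k μ ν z i - uA F θ g k μ ν z i| ≤ cA F θ * θK F θ ^ (k + 1) * Real.exp (-(κK F θ * l1 (p₁ F θ k μ ν z - q F θ k i))))
    (hdC : ∀ (F : T4Family) (θ : Stage13HParams F N), θ.Provisos₁₃CoPH F N → Rg F θ → θ.Admissible F N →
      ∀ b : ℝ, 0 < b → b ≤ θ.γ → ∀ g ∈ Window θ.γ, ∀ (k : ℕ) (μ ν : Fin 4) (z : Fin 4 → ℤ) (i i' : βK F θ k),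
        |CB F θ b g k μ ν z i i' - CA F θ g k μ ν z i i'| ≤ cC F θ * θK F θ ^ (k + 1) * Real.exp (-(κK F θ * l1 (q F θ k i - q F θ k i'))))
    (hdv : ∀ (F : T4Family) (θ : Stage13HParams F N), θ.Provisos₁₃CoPH F N → Rg F θ → θ.Admissible F N →
      ∀ b : ℝ, 0 < b → b ≤ θ.γ → ∀ g ∈ Window θ.γ, ∀ (k : ℕ) (μ ν : Fin 4) (z : Fin 4 → ℤ) (i' : βK F θ k),
        |vB F θ b g k μ ν z i' - vA F θ g k μ ν z i'| ≤ cB F θ * θK F θ ^ (k + 1) * Real.exp (-(κK F θ * l1 (q F θ k i' - p₂ F θ k μ ν z))))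
    (hdom : ∀ (F : T4Family) (θ : Stage13HParams F N), θ.Provisos₁₃CoPH F N → Rg F θ → θ.Admissible F N →
      (ℓ F θ).κ ≤ κK F θ / 2 ∧ θK F θ ≤ (ℓ F θ).θ₅ ∧
        (cA F θ * sC F θ * sB F θ + sA F θ * cC F θ * sB F θ + sA F θ * sC F θ * cB F θ) * K₁ 4 (κK F θ / 2) ^ 2 ≤ (ℓ F θ).C₅)
    (hsel : ∀ (F : T4Family) (θ : Stage13HParams F N), θ.Provisos₁₃CoPH F N → Rg F θ → θ.Admissible F N →
      ∃ E : B12.RunParams → ℝ, θ.ppSel = ppSelLiveOfRecord F N θ.ν θ.τ9 E (wOfRecord₉ F N θ.toStage9Params))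
    (hζm : ∀ (F : T4Family) (θ : Stage13HParams F N), θ.Provisos₁₃CoPH F N → Rg F θ → θ.Admissible F N → ZetaMeasurable F N θ.ζ)
    (h20 : ∀ (F : T4Family) (θ : Stage13HParams F N) (hP : θ.Provisos₁₃CoPH F N), Rg F θ → θ.Admissible F N →
      ∀ (g₀ : ℕ → ℝ) (os : List (ULoop F)),
        ∃ W : ℕ → ℝ, RelWeightBound 1 (classSet₁₃ θ K₀ g₀) (weightA₁₃ θ hP K₀ g₀ os) (weightB₁₃ θ hP K₀ g₀ os) (badClass₁₃ θ K₀ g₀ (jc F θ hP g₀ os)) W)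
    (h21 : ∀ (F : T4Family) (θ : Stage13HParams F N) (hP : θ.Provisos₁₃CoPH F N), Rg F θ → θ.Admissible F N →
      ∀ (g₀ : ℕ → ℝ) (os : List (ULoop F)),
        ∃ Wsh : ℕ → ℝ, ShellWeightBound 1 (classSet₁₃ θ K₀ g₀) (weightA₁₃ θ hP K₀ g₀ os) (weightB₁₃ θ hP K₀ g₀ os) (sh F θ hP g₀ os).1 (sh F θ hP g₀ os).2 Wsh)
    (h19 : ∀ (F : T4Family) (θ : Stage13HParams F N) (hP : θ.Provisos₁₃CoPH F N), Rg F θ → θ.Admissible F N →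
      B16.EndStatementBPrinted (datumOfRecord₁₃CoPH F N θ hP).C → DagBinding.EndpointExistence (datumOfRecord₁₃CoPH F N θ hP).C.toB12 →
        ForSmallCouplings (datumOfRecord₁₃CoPH F N θ hP) fun g₀ => ∀ os : List (ULoop F),
          (RatesHolderAt (datumOfRecord₁₃CoPH F N θ hP) (rateCarriersOfRecord₁₃CoPH 𝔯 F θ hP g₀ os (ksel F θ hP g₀ os)) β ∧
              ReadOutAt (datumOfRecord₁₃CoPH F N θ hP) (rateCarriersOfRecord₁₃CoPH 𝔯 F θ hP g₀ os (ksel F θ hP g₀ os)).u3 ∧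
              (0 ≤ (rateCarriersOfRecord₁₃CoPH 𝔯 F θ hP g₀ os (ksel F θ hP g₀ os)).u3.ρ ∧
                (rateCarriersOfRecord₁₃CoPH 𝔯 F θ hP g₀ os (ksel F θ hP g₀ os)).u3.ρ < 1)) →
            letI : DecidableEq (Σ K, SiteSeqKey F (K₀ + K)) := Classical.decEq _
            ∃ δ : ℕ → ℝ, NE7.Core 1 (F.side ^ 4) (classSet₁₃ θ K₀ g₀) (badClass₁₃ θ K₀ g₀ (jc F θ hP g₀ os))
              (fun K t x => weightA₁₃ θ hP K₀ g₀ os K t x - (sh F θ hP g₀ os).1 K t x)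
              (fun K t x => weightB₁₃ θ hP K₀ g₀ os K t x - (sh F θ hP g₀ os).2 K t x) δ ∧ Summable δ) :
    Spine (N := N) fun F D w => Node00.IsRecordOfRecord₁₃CCoPHOn F N Rg D w := by
  obtain ⟨hdec, h18⟩ := kernelRowsOfRecord₁₃_guarded_of_kingMechanismZ4 ℓ q p₁ p₂ uA vA CA uB vB CB κK θK sA sC sB cA cC cB Rg hs hks hq hd hEA hEB hu hCA hvA hCB hvB hdu hdC hdv hdom
  exact spine_rec13CCoPHOn_of_kernels_pin_fsc_at_crOfRecord₁₃VAt_cut K₀ jc sh β 𝔯 ksel ℓ Rg hpin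
    (fun F θ hP hRg hθ _ _ => ForSmallCouplings.of_forall fun g₀ os => by
      refine ⟨?_, ?_, ?_⟩
      · exact n14At_rateCarriersOfRecord₁₃CoPH_of_pinned 𝔯 hpin1 F θ hP g₀ os (ksel F θ hP g₀ os)
      · obtain ⟨b, aS, ν, μ, α, β', c35, p, hb, haS, h⟩ := hpin2
        rw [h F θ hP g₀ os]
        exact n15At_fullGSizedObjects_family hb haS ν μ α β' c35 p F
      · show N16HolderAt (rateCarriersOfRecord₁₃CoPH 𝔯 F θ hP g₀ os (ksel F θ hP g₀ os)).ne3 β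
        rw [rateCarriers_ne3_of_pinnedLoose hpinL F θ hP g₀ os (ksel F θ hP g₀ os)]
        exact h16 F ⟨θ, hP, hRg, hθ⟩)
    hs hκ hcr hρ hdec h18
    (fun F θ hP hRg hθ k => n22At_u3OfRecord₁₃_objectsOfRecord₁₃_of_geometricIncrements_of_windowedNE9 F N θ.toStage13Params (ℓ F θ) (hs F θ hP hRg hθ) k (hr F θ hP hRg hθ)
      (hinc F θ hP hRg hθ) (h9 F θ hP hRg hθ))
    hsel hζm h20 h21 h19

/-! ## §2 ON THE LIVE-SELECTOR LINE of a regime `G` (`Rg := G ∧ LiveSel` spelled `N`-generically; `hsel := hRg.2`) -/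

section Live

variable (G : (F : T4Family) → Stage13HParams F N → Prop)

/-- ★★★ **§1 ON THE LIVE LINE OF A REGIME `G`**: at `N = 2`, `G :=` the item's guard, `K₀ = 0` the displayed binders ARE v5's stub-1 content AT ITS FOUR PINS (rows discharged; `h16` + `hr hinc h9`
+ KING's ℤ⁴ MECHANISM ROWS for the (D4) ∕ N18 inputs + letter rows + the FSC `h19` face remain) and v5's stub-2 content AT THE SPINE PIN (keyed N20 ∕ N21 witnesses; N27x a theorem), composed to
B5 on the live line — the leaf `…SepCoPHAllPinsOfRecordVKingMechanismZ4` gives THE ITEM.  Every row a HYPOTHESIS or a decided MODEL; King's rows NOT PRINTED for d = 4. [bookkeeping] -/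
theorem spine_rec13CCoPHOn_live_of_v5pins_fsc_at_crOfRecord₁₃VAt_cut_of_kingMechanismZ4
    (hpin1 : Ne1PinnedOfRecord 𝔯)
    (hpin2 : ∃ (b aS : ℝ) (ν μ α β' : Fin 4) (c35 p : ℝ), 0 < b ∧ 0 < aS ∧
      ∀ (F : T4Family) (θ : Stage13HParams F N) (hP : θ.Provisos₁₃CoPH F N) (g₀ : ℕ → ℝ) (os : List (ULoop F)) (k : ℕ),
        (𝔯.lit F θ hP g₀ os).ne2 k = haveI := neZero_blockFactor F; fullGSizedObjects 3 F.hL b aS ν μ α β' c35 p)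
    (hpinL : N16PinnedLoose 𝔯 ℓ₃ B)
    (hpin : ∀ (F : T4Family) (θ : Stage13HParams F N) (hP : θ.Provisos₁₃CoPH F N) (g₀ : ℕ → ℝ) (os : List (ULoop F)),
      (𝔯.lit F θ hP g₀ os).u3 = objectsOfRecord₁₃ F N θ.toStage13Params (ℓ F θ))
    (h16 : ∀ (F : T4Family), (∃ θ : Stage13HParams F N, θ.Provisos₁₃CoPH F N ∧ (G F θ ∧ θ.ppSel = ppSelLiveOfRecord F N θ.ν θ.τ9 (EOfRecord₁₃ F N θ.toStage13Params) (wOfRecord₉ F N θ.toStage9Params)) ∧ θ.Admissible F N) →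
      N16HolderAt (ne3OfRecord₁₁ F { ne3ConstLayerOfRecord₁₁ F N (ℓ₃ F) with
        dom := {V | V ∈ ne3DomOfRecord₁₁ F N 0 0 ∧ V ∈ sfClass 4 F.L (ne3NperOfRecord₁₁ F 0 0) ((ℓ₃ F).ε / B F) 0} }) β)
    (hs : ∀ (F : T4Family) (θ : Stage13HParams F N), θ.Provisos₁₃CoPH F N → (G F θ ∧ θ.ppSel = ppSelLiveOfRecord F N θ.ν θ.τ9 (EOfRecord₁₃ F N θ.toStage13Params) (wOfRecord₉ F N θ.toStage9Params)) → θ.Admissible F N → (ℓ F θ).Signs)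
    (hκ : ∀ (F : T4Family) (θ : Stage13HParams F N), θ.Provisos₁₃CoPH F N → (G F θ ∧ θ.ppSel = ppSelLiveOfRecord F N θ.ν θ.τ9 (EOfRecord₁₃ F N θ.toStage13Params) (wOfRecord₉ F N θ.toStage9Params)) → θ.Admissible F N → 0 < (ℓ F θ).κ)
    (hcr : ∀ (F : T4Family) (θ : Stage13HParams F N), θ.Provisos₁₃CoPH F N → (G F θ ∧ θ.ppSel = ppSelLiveOfRecord F N θ.ν θ.τ9 (EOfRecord₁₃ F N θ.toStage13Params) (wOfRecord₉ F N θ.toStage9Params)) → θ.Admissible F N →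
      betaPrime510 4 1 (ℓ F θ).κ ≤ (ℓ F θ).cr)
    (hρ : ∀ (F : T4Family) (θ : Stage13HParams F N), θ.Provisos₁₃CoPH F N → (G F θ ∧ θ.ppSel = ppSelLiveOfRecord F N θ.ν θ.τ9 (EOfRecord₁₃ F N θ.toStage13Params) (wOfRecord₉ F N θ.toStage9Params)) → θ.Admissible F N →
      0 ≤ (ℓ F θ).ρ ∧ (ℓ F θ).ρ < 1)
    (hr : ∀ (F : T4Family) (θ : Stage13HParams F N), θ.Provisos₁₃CoPH F N → (G F θ ∧ θ.ppSel = ppSelLiveOfRecord F N θ.ν θ.τ9 (EOfRecord₁₃ F N θ.toStage13Params) (wOfRecord₉ F N θ.toStage9Params)) → θ.Admissible F N → r F θ < 1)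
    (hinc : ∀ (F : T4Family) (θ : Stage13HParams F N), θ.Provisos₁₃CoPH F N → (G F θ ∧ θ.ppSel = ppSelLiveOfRecord F N θ.ν θ.τ9 (EOfRecord₁₃ F N θ.toStage13Params) (wOfRecord₉ F N θ.toStage9Params)) → θ.Admissible F N →
      GeometricIncrementsOfRecord₁₃ F N θ.toStage13Params (r F θ))
    (h9 : ∀ (F : T4Family) (θ : Stage13HParams F N), θ.Provisos₁₃CoPH F N → (G F θ ∧ θ.ppSel = ppSelLiveOfRecord F N θ.ν θ.τ9 (EOfRecord₁₃ F N θ.toStage13Params) (wOfRecord₉ F N θ.toStage9Params)) → θ.Admissible F N →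
      WindowedNE9OfRecord₁₃ F N θ.toStage13Params (ℓ F θ).κ (ℓ F θ).moduli)
    (hks : ∀ (F : T4Family) (θ : Stage13HParams F N), θ.Provisos₁₃CoPH F N → (G F θ ∧ θ.ppSel = ppSelLiveOfRecord F N θ.ν θ.τ9 (EOfRecord₁₃ F N θ.toStage13Params) (wOfRecord₉ F N θ.toStage9Params)) → θ.Admissible F N →
      0 < κK F θ ∧ 0 ≤ θK F θ ∧ 0 ≤ sA F θ ∧ 0 ≤ sC F θ ∧ 0 ≤ sB F θ ∧ 0 ≤ cA F θ ∧ 0 ≤ cC F θ ∧ 0 ≤ cB F θ)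
    (hq : ∀ (F : T4Family) (θ : Stage13HParams F N) (k : ℕ), Function.Injective (q F θ k))
    (hd : ∀ (F : T4Family) (θ : Stage13HParams F N) (k : ℕ) (μ ν : Fin 4) (z : Fin 4 → ℤ), l1 z ≤ l1 (p₁ F θ k μ ν z - p₂ F θ k μ ν z))
    (hEA : ∀ (F : T4Family) (θ : Stage13HParams F N), θ.Provisos₁₃CoPH F N → (G F θ ∧ θ.ppSel = ppSelLiveOfRecord F N θ.ν θ.τ9 (EOfRecord₁₃ F N θ.toStage13Params) (wOfRecord₉ F N θ.toStage9Params)) → θ.Admissible F N →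
      ∀ g ∈ Window θ.γ, ∀ (k : ℕ) (μ ν : Fin 4) (z : Fin 4 → ℤ),
        (objectsOfRecord₁₃ F N θ.toStage13Params (ℓ F θ)).EA k g PUnit.unit (pt k μ ν z) = uA F θ g k μ ν z ⬝ᵥ (CA F θ g k μ ν z *ᵥ vA F θ g k μ ν z))
    (hEB : ∀ (F : T4Family) (θ : Stage13HParams F N), θ.Provisos₁₃CoPH F N → (G F θ ∧ θ.ppSel = ppSelLiveOfRecord F N θ.ν θ.τ9 (EOfRecord₁₃ F N θ.toStage13Params) (wOfRecord₉ F N θ.toStage9Params)) → θ.Admissible F N →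
      ∀ b : ℝ, 0 < b → b ≤ θ.γ → ∀ g ∈ Window θ.γ, ∀ (k : ℕ) (μ ν : Fin 4) (z : Fin 4 → ℤ),
        (objectsOfRecord₁₃ F N θ.toStage13Params (ℓ F θ)).EB k b g (bg k μ ν z) (pt k μ ν z) = uB F θ b g k μ ν z ⬝ᵥ (CB F θ b g k μ ν z *ᵥ vB F θ b g k μ ν z))
    (hu : ∀ (F : T4Family) (θ : Stage13HParams F N), θ.Provisos₁₃CoPH F N → (G F θ ∧ θ.ppSel = ppSelLiveOfRecord F N θ.ν θ.τ9 (EOfRecord₁₃ F N θ.toStage13Params) (wOfRecord₉ F N θ.toStage9Params)) → θ.Admissible F N →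
      ∀ g ∈ Window θ.γ, ∀ (k : ℕ) (μ ν : Fin 4) (z : Fin 4 → ℤ) (i : βK F θ k),
        |uA F θ g k μ ν z i| ≤ sA F θ * Real.exp (-(κK F θ * l1 (p₁ F θ k μ ν z - q F θ k i))))
    (hCA : ∀ (F : T4Family) (θ : Stage13HParams F N), θ.Provisos₁₃CoPH F N → (G F θ ∧ θ.ppSel = ppSelLiveOfRecord F N θ.ν θ.τ9 (EOfRecord₁₃ F N θ.toStage13Params) (wOfRecord₉ F N θ.toStage9Params)) → θ.Admissible F N →
      ∀ g ∈ Window θ.γ, ∀ (k : ℕ) (μ ν : Fin 4) (z : Fin 4 → ℤ) (i i' : βK F θ k),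
        |CA F θ g k μ ν z i i'| ≤ sC F θ * Real.exp (-(κK F θ * l1 (q F θ k i - q F θ k i'))))
    (hvA : ∀ (F : T4Family) (θ : Stage13HParams F N), θ.Provisos₁₃CoPH F N → (G F θ ∧ θ.ppSel = ppSelLiveOfRecord F N θ.ν θ.τ9 (EOfRecord₁₃ F N θ.toStage13Params) (wOfRecord₉ F N θ.toStage9Params)) → θ.Admissible F N →
      ∀ g ∈ Window θ.γ, ∀ (k : ℕ) (μ ν : Fin 4) (z : Fin 4 → ℤ) (i' : βK F θ k),
        |vA F θ g k μ ν z i'| ≤ sB F θ * Real.exp (-(κK F θ * l1 (q F θ k i' - p₂ F θ k μ ν z))))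
    (hCB : ∀ (F : T4Family) (θ : Stage13HParams F N), θ.Provisos₁₃CoPH F N → (G F θ ∧ θ.ppSel = ppSelLiveOfRecord F N θ.ν θ.τ9 (EOfRecord₁₃ F N θ.toStage13Params) (wOfRecord₉ F N θ.toStage9Params)) → θ.Admissible F N →
      ∀ b : ℝ, 0 < b → b ≤ θ.γ → ∀ g ∈ Window θ.γ, ∀ (k : ℕ) (μ ν : Fin 4) (z : Fin 4 → ℤ) (i i' : βK F θ k),
        |CB F θ b g k μ ν z i i'| ≤ sC F θ * Real.exp (-(κK F θ * l1 (q F θ k i - q F θ k i'))))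
    (hvB : ∀ (F : T4Family) (θ : Stage13HParams F N), θ.Provisos₁₃CoPH F N → (G F θ ∧ θ.ppSel = ppSelLiveOfRecord F N θ.ν θ.τ9 (EOfRecord₁₃ F N θ.toStage13Params) (wOfRecord₉ F N θ.toStage9Params)) → θ.Admissible F N →
      ∀ b : ℝ, 0 < b → b ≤ θ.γ → ∀ g ∈ Window θ.γ, ∀ (k : ℕ) (μ ν : Fin 4) (z : Fin 4 → ℤ) (i' : βK F θ k),
        |vB F θ b g k μ ν z i'| ≤ sB F θ * Real.exp (-(κK F θ * l1 (q F θ k i' - p₂ F θ k μ ν z))))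
    (hdu : ∀ (F : T4Family) (θ : Stage13HParams F N), θ.Provisos₁₃CoPH F N → (G F θ ∧ θ.ppSel = ppSelLiveOfRecord F N θ.ν θ.τ9 (EOfRecord₁₃ F N θ.toStage13Params) (wOfRecord₉ F N θ.toStage9Params)) → θ.Admissible F N →
      ∀ b : ℝ, 0 < b → b ≤ θ.γ → ∀ g ∈ Window θ.γ, ∀ (k : ℕ) (μ ν : Fin 4) (z : Fin 4 → ℤ) (i : βK F θ k),
        |uB F θ b g k μ ν z i - uA F θ g k μ ν z i| ≤ cA F θ * θK F θ ^ (k + 1) * Real.exp (-(κK F θ * l1 (p₁ F θ k μ ν z - q F θ k i))))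
    (hdC : ∀ (F : T4Family) (θ : Stage13HParams F N), θ.Provisos₁₃CoPH F N → (G F θ ∧ θ.ppSel = ppSelLiveOfRecord F N θ.ν θ.τ9 (EOfRecord₁₃ F N θ.toStage13Params) (wOfRecord₉ F N θ.toStage9Params)) → θ.Admissible F N →
      ∀ b : ℝ, 0 < b → b ≤ θ.γ → ∀ g ∈ Window θ.γ, ∀ (k : ℕ) (μ ν : Fin 4) (z : Fin 4 → ℤ) (i i' : βK F θ k),
        |CB F θ b g k μ ν z i i' - CA F θ g k μ ν z i i'| ≤ cC F θ * θK F θ ^ (k + 1) * Real.exp (-(κK F θ * l1 (q F θ k i - q F θ k i'))))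
    (hdv : ∀ (F : T4Family) (θ : Stage13HParams F N), θ.Provisos₁₃CoPH F N → (G F θ ∧ θ.ppSel = ppSelLiveOfRecord F N θ.ν θ.τ9 (EOfRecord₁₃ F N θ.toStage13Params) (wOfRecord₉ F N θ.toStage9Params)) → θ.Admissible F N →
      ∀ b : ℝ, 0 < b → b ≤ θ.γ → ∀ g ∈ Window θ.γ, ∀ (k : ℕ) (μ ν : Fin 4) (z : Fin 4 → ℤ) (i' : βK F θ k),
        |vB F θ b g k μ ν z i' - vA F θ g k μ ν z i'| ≤ cB F θ * θK F θ ^ (k + 1) * Real.exp (-(κK F θ * l1 (q F θ k i' - p₂ F θ k μ ν z))))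
    (hdom : ∀ (F : T4Family) (θ : Stage13HParams F N), θ.Provisos₁₃CoPH F N → (G F θ ∧ θ.ppSel = ppSelLiveOfRecord F N θ.ν θ.τ9 (EOfRecord₁₃ F N θ.toStage13Params) (wOfRecord₉ F N θ.toStage9Params)) → θ.Admissible F N →
      (ℓ F θ).κ ≤ κK F θ / 2 ∧ θK F θ ≤ (ℓ F θ).θ₅ ∧
        (cA F θ * sC F θ * sB F θ + sA F θ * cC F θ * sB F θ + sA F θ * sC F θ * cB F θ) * K₁ 4 (κK F θ / 2) ^ 2 ≤ (ℓ F θ).C₅)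
    (hζm : ∀ (F : T4Family) (θ : Stage13HParams F N), θ.Provisos₁₃CoPH F N → (G F θ ∧ θ.ppSel = ppSelLiveOfRecord F N θ.ν θ.τ9 (EOfRecord₁₃ F N θ.toStage13Params) (wOfRecord₉ F N θ.toStage9Params)) → θ.Admissible F N →
      ZetaMeasurable F N θ.ζ)
    (h20 : ∀ (F : T4Family) (θ : Stage13HParams F N) (hP : θ.Provisos₁₃CoPH F N), (G F θ ∧ θ.ppSel = ppSelLiveOfRecord F N θ.ν θ.τ9 (EOfRecord₁₃ F N θ.toStage13Params) (wOfRecord₉ F N θ.toStage9Params)) → θ.Admissible F N →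
      ∀ (g₀ : ℕ → ℝ) (os : List (ULoop F)),
        ∃ W : ℕ → ℝ, RelWeightBound 1 (classSet₁₃ θ K₀ g₀) (weightA₁₃ θ hP K₀ g₀ os) (weightB₁₃ θ hP K₀ g₀ os) (badClass₁₃ θ K₀ g₀ (jc F θ hP g₀ os)) W)
    (h21 : ∀ (F : T4Family) (θ : Stage13HParams F N) (hP : θ.Provisos₁₃CoPH F N), (G F θ ∧ θ.ppSel = ppSelLiveOfRecord F N θ.ν θ.τ9 (EOfRecord₁₃ F N θ.toStage13Params) (wOfRecord₉ F N θ.toStage9Params)) → θ.Admissible F N →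
      ∀ (g₀ : ℕ → ℝ) (os : List (ULoop F)),
        ∃ Wsh : ℕ → ℝ, ShellWeightBound 1 (classSet₁₃ θ K₀ g₀) (weightA₁₃ θ hP K₀ g₀ os) (weightB₁₃ θ hP K₀ g₀ os) (sh F θ hP g₀ os).1 (sh F θ hP g₀ os).2 Wsh)
    (h19 : ∀ (F : T4Family) (θ : Stage13HParams F N) (hP : θ.Provisos₁₃CoPH F N), (G F θ ∧ θ.ppSel = ppSelLiveOfRecord F N θ.ν θ.τ9 (EOfRecord₁₃ F N θ.toStage13Params) (wOfRecord₉ F N θ.toStage9Params)) → θ.Admissible F N →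
      B16.EndStatementBPrinted (datumOfRecord₁₃CoPH F N θ hP).C → DagBinding.EndpointExistence (datumOfRecord₁₃CoPH F N θ hP).C.toB12 →
        ForSmallCouplings (datumOfRecord₁₃CoPH F N θ hP) fun g₀ => ∀ os : List (ULoop F),
          (RatesHolderAt (datumOfRecord₁₃CoPH F N θ hP) (rateCarriersOfRecord₁₃CoPH 𝔯 F θ hP g₀ os (ksel F θ hP g₀ os)) β ∧
              ReadOutAt (datumOfRecord₁₃CoPH F N θ hP) (rateCarriersOfRecord₁₃CoPH 𝔯 F θ hP g₀ os (ksel F θ hP g₀ os)).u3 ∧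
              (0 ≤ (rateCarriersOfRecord₁₃CoPH 𝔯 F θ hP g₀ os (ksel F θ hP g₀ os)).u3.ρ ∧
                (rateCarriersOfRecord₁₃CoPH 𝔯 F θ hP g₀ os (ksel F θ hP g₀ os)).u3.ρ < 1)) →
            letI : DecidableEq (Σ K, SiteSeqKey F (K₀ + K)) := Classical.decEq _
            ∃ δ : ℕ → ℝ, NE7.Core 1 (F.side ^ 4) (classSet₁₃ θ K₀ g₀) (badClass₁₃ θ K₀ g₀ (jc F θ hP g₀ os))
              (fun K t x => weightA₁₃ θ hP K₀ g₀ os K t x - (sh F θ hP g₀ os).1 K t x)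
              (fun K t x => weightB₁₃ θ hP K₀ g₀ os K t x - (sh F θ hP g₀ os).2 K t x) δ ∧ Summable δ) :
    Spine (N := N) fun F D w => Node00.IsRecordOfRecord₁₃CCoPHOn F N
      (fun F θ => G F θ ∧ θ.ppSel = ppSelLiveOfRecord F N θ.ν θ.τ9 (EOfRecord₁₃ F N θ.toStage13Params) (wOfRecord₉ F N θ.toStage9Params)) D w :=
  spine_rec13CCoPHOn_of_v5pins_fsc_at_crOfRecord₁₃VAt_cut_of_kingMechanismZ4 K₀ jc sh β 𝔯 ksel ℓ r ℓ₃ B q p₁ p₂ uA vA CA uB vB CB κK θK sA sC sB cA cC cB _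
    hpin1 hpin2 hpinL hpin h16 hs hκ hcr hρ hr hinc h9 hks hq hd hEA hEB hu hCA hvA hCB hvB hdu hdC hdv hdom
    (fun _ _ _ hRg _ => ⟨_, hRg.2⟩) hζm h20 h21 h19

end Live

end Summit.QuantumFields.YangMills.Theorems.BalabanUVNodesN27SpineRecord
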